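import Summits.CriticalPhenomena.PercolationContinuityZ3.Theorems.PercNearOneGluingNoHeavyPcintUFibProcess
import HarnessLib

/-!
# PCINT lane, T-fibre route PHASE 2, step (3aU): the fibres of the usable-set process factorise

Cell `prim-pcint`, seat `prim-pcint-1` (gen 12); memo `run/shared/lean/prim/pcint/T-FIBRE-ROUTE.md` (PHASE 2).

The structural ("Markov") half of the domination step for the usable-set oracle `UFib.outU`
(`…PcintUFibProcess.lean`) run with `ClusterExpl.rule` on a finite `Λ ⊆ 𝕋`; the analogue of `…PcintTFibFactor.lean`,
whose oracle-independent step context `TFib.StepF` (a state equal to its own replay, selected site `c ≠ o` examined at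
step `k₀` by `d`; its fibre-size parameter is irrelevant to its fields and is instantiated at `1`) is reused.

* `FibU`, `run_eq_iff_fibU` — the fibre tests of the usable-set oracle (`AdaptDom.run_eq_iff_replay`).
* `usableX_mixG_eq` — **locality of usable sets**: resampling a set `W` of sites that are neither examined (except
  one exceptional site `e`) nor selected before step `N` does not change the usable sets of the sites `≠ e`.
* `H X w` — the TYPE of the step: the usable set of the examiner `d` (a function of `w` off `W₀ = {c} ∪ C`).
* **`fibU_mixG_iff`** — `FibU (mixG W₀ u w) ↔ FibRestU w ∧ meetsU (u c) (H w)`: `c` is read exactly once before its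
  selection, through the reach test against its examiner's usable set; the children are unread.
* `outU_mixG_children` — at `σ` the children `a ∈ C` report `meetsU (u a) (υ (u c) (H w))`.
* `fibU_origin_mixG_iff`, `outU_origin_mixG_children` — the origin step: root test `u o = uAll`, children report
  `meetsU (u a) Φ`.
-/

noncomputable section

namespace Summit.CriticalPhenomena.PercolationContinuityZ3.Theorems.Pcint

namespace UFib

open Finset AdaptDom ClusterExpl TFib Literature.Probability.Percolation Literature.Probability.LatticeModels

variable {Φ : Type*} [Fintype Φ]
variable (υ : (Φ → Bool) → Finset Φ → Finset Φ) {Λ : Finset (Site 2)} (enc : ↥Λ → ℕ) (o : ↥Λ)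

/-! ### The fibre tests -/

/-- **The fibre tests of the usable-set oracle**: `w` passes iff at every replayed state before step `n` the oracle
reports, on every examined site, the value recorded in `σ`. -/
def FibU (n : ℕ) (σ : ↥Λ → Option Bool) (w : ↥Λ → (Φ → Bool)) : Prop :=
  ∀ k < n, ∀ a ∈ rule (boxGraphT Λ) enc o (traj enc o σ k), outU υ Λ enc o w (traj enc o σ k) a = (σ a).getD false

/-- **Fibres of the run**: `run_n(w) = σ` iff `σ` is its own replay and `w` passes the fibre tests. -/
theorem run_eq_iff_fibU (n : ℕ) (σ : ↥Λ → Option Bool) (w : ↥Λ → (Φ → Bool)) :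
    run (rule (boxGraphT Λ) enc o) (outU υ Λ enc o w) n = σ ↔ traj enc o σ n = σ ∧ FibU υ enc o n σ w :=
  run_eq_iff_replay (rule_unrevealed (boxGraphT Λ) enc o) _ n σ

/-- `traj` is the run of the replay oracle (definitional unfolding). -/
theorem traj_eq (σ : ↥Λ → Option Bool) (k : ℕ) :
    traj enc o σ k = run (rule (boxGraphT Λ) enc o) (readOut σ) k := rfl

variable {enc o}

/-! ### Locality of usable sets under resampling -/

/-- **Locality**: let `W` be a set of sites and `e` a site such that, before step `N` of the replay of `σ`, every site
examined at a non-initial step is `e` or outside `W`, and no selected site is `e`.  Then resampling `W` does not change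
the usable sets of the sites other than `e` up to step `N`. -/
theorem usableX_mixG_eq (σ : ↥Λ → Option Bool) (W : Finset ↥Λ) (e : ↥Λ) (N : ℕ)
    (ha : ∀ j < N, ¬ (∀ v, traj enc o σ j v = none) → ∀ v ∈ rule (boxGraphT Λ) enc o (traj enc o σ j), v ≠ e → v ∉ W)
    (hb : ∀ j < N, ¬ (∀ v, traj enc o σ j v = none) → ∀ b, sel (boxGraphT Λ) enc (traj enc o σ j) = some b → b ≠ e)
    (u w : ↥Λ → (Φ → Bool)) :
    ∀ k ≤ N, ∀ v, v ≠ e → usableX υ Λ enc o (mixG W u w) (readOut σ) k v = usableX υ Λ enc o w (readOut σ) k v := by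
  intro k hk
  induction k with
  | zero => intro v _; rfl
  | succ k ih =>
    intro v hve
    have ih' := ih (Nat.le_of_succ_le hk)
    have hkN : k < N := Nat.lt_of_succ_le hk
    by_cases hvR : v ∈ rule (boxGraphT Λ) enc o (run (rule (boxGraphT Λ) enc o) (readOut σ) k)
    · by_cases hinit : ∀ u', run (rule (boxGraphT Λ) enc o) (readOut σ) k u' = none
      · rw [usableX_succ_of_init _ _ hvR hinit, usableX_succ_of_init _ _ hvR hinit]
      · cases hsel : sel (boxGraphT Λ) enc (run (rule (boxGraphT Λ) enc o) (readOut σ) k) with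
        | none =>
          exfalso
          rw [rule_eq_empty_of_sel_eq_none (boxGraphT Λ) enc o hinit hsel] at hvR
          simp at hvR
        | some b =>
          rw [usableX_succ_of_sel _ _ hvR hinit hsel, usableX_succ_of_sel _ _ hvR hinit hsel]
          have hbe : b ≠ e := hb k hkN hinit b hsel
          have hvW : v ∉ W := ha k hkN hinit v hvR hve
          rw [ih' b hbe, mixG_of_not_mem hvW]
    · rw [usableX_succ_of_not_mem _ _ hvR, usableX_succ_of_not_mem _ _ hvR]
      exact ih' v hve

/-- **The oracle's usable set at a replayed state**: if `b` was examined at step `k_b < k` of the replay of `σ`, then at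
`traj σ k` the oracle reads `usableX w (readOut σ) (k_b + 1) b`. -/
theorem usableAt_traj (w : ↥Λ → (Φ → Bool)) (σ : ↥Λ → Option Bool) {k kb : ℕ} (hkb : kb < k) {b : ↥Λ}
    (hb : b ∈ rule (boxGraphT Λ) enc o (traj enc o σ kb)) :
    usableAt υ Λ enc o w (traj enc o σ k) b = usableX υ Λ enc o w (readOut σ) (kb + 1) b :=
  usableAt_run w (readOut σ) hkb hb

omit [Fintype Φ] in
/-- Helper: a non-initial replayed state has step index `≥ 1`. -/
theorem one_le_of_not_init (σ : ↥Λ → Option Bool) {j : ℕ} (hne : ¬ ∀ v, traj enc o σ j v = none) : 1 ≤ j := by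
  rcases Nat.eq_zero_or_pos j with rfl | hpos
  · exact absurd (fun v => rfl) hne
  · exact hpos

/-- A site selected at step `k` of a replay was examined at an earlier step. -/
theorem exists_step_of_sel (σ : ↥Λ → Option Bool) {k : ℕ} {b : ↥Λ}
    (hsel : sel (boxGraphT Λ) enc (traj enc o σ k) = some b) :
    ∃ kb < k, b ∈ rule (boxGraphT Λ) enc o (traj enc o σ kb) :=
  exists_step_of_run_ne_none (boxGraphT Λ) enc o (readOut σ) k b
    (by rw [← traj_eq, (sel_revealedTrue (boxGraphT Λ) enc hsel).1]; simp)

/-! ### The general step: selected site `c ≠ o` examined at `k₀` by `d` -/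

variable (X : StepF (Λ := Λ) enc o 1)

/-- **The type of the step**: the usable set of the examiner `d` of `c` (at the examination of `c`). -/
def H (w : ↥Λ → (Φ → Bool)) : Finset Φ := usableX υ Λ enc o w (readOut X.σ) X.k₀ X.d

/-- The fibre tests other than the test of `c` (at step `k₀`). -/
def FibRestU (w : ↥Λ → (Φ → Bool)) : Prop :=
  ∀ k < X.n, ∀ a ∈ rule (boxGraphT Λ) enc o (traj enc o X.σ k), ¬ (k = X.k₀ ∧ a = X.c) →
    outU υ Λ enc o w (traj enc o X.σ k) a = (X.σ a).getD false

/-- Locality hypotheses of `usableX_mixG_eq` for `W₀ = {c} ∪ C`, `e = c`, `N = n`. -/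
theorem usableX_mixG_W₀ (u w : ↥Λ → (Φ → Bool)) :
    ∀ k ≤ X.n, ∀ v, v ≠ X.c → usableX υ Λ enc o (mixG X.W₀ u w) (readOut X.σ) k v = usableX υ Λ enc o w (readOut X.σ) k v := by
  refine usableX_mixG_eq υ X.σ X.W₀ X.c X.n (fun j hj hne v hv hvc => ?_) (fun j hj hne b hb => ?_) u w
  · rw [X.mem_W₀]
    rintro (h | h)
    · exact hvc h
    · have h0 := (X.mem_C h).1
      rw [← X.hcons] at h0
      exact not_mem_rule_of_run_apply_eq_none (boxGraphT Λ) enc o (readOut X.σ) hj h0 hv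
  · intro hbc
    exact X.not_mem_W₀_of_sel (one_le_of_not_init X.σ hne) hj hb (hbc ▸ X.c_mem_W₀)

/-- The type does not read `W₀`. -/
theorem H_mixG (u w : ↥Λ → (Φ → Bool)) : H υ X (mixG X.W₀ u w) = H υ X w :=
  usableX_mixG_W₀ υ X u w X.k₀ X.hk₀.le X.d X.d_ne_c

/-- **At a replayed state before step `n` with selected site `b`, the oracle's usable set of `b` does not read `W₀`.** -/
theorem usableAt_traj_mixG {k : ℕ} (hk : k < X.n) (hne : ¬ ∀ v, traj enc o X.σ k v = none) {b : ↥Λ}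
    (hsel : sel (boxGraphT Λ) enc (traj enc o X.σ k) = some b) (u w : ↥Λ → (Φ → Bool)) :
    usableAt υ Λ enc o (mixG X.W₀ u w) (traj enc o X.σ k) b = usableAt υ Λ enc o w (traj enc o X.σ k) b := by
  obtain ⟨kb, hkb, hbR⟩ := exists_step_of_sel X.σ hsel
  have hbc : b ≠ X.c := fun hbc => X.not_mem_W₀_of_sel (one_le_of_not_init X.σ hne) hk hsel (hbc ▸ X.c_mem_W₀)
  rw [usableAt_traj υ _ _ hkb hbR, usableAt_traj υ _ _ hkb hbR]
  exact usableX_mixG_W₀ υ X u w (kb + 1) (by omega) b hbc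

/-- **The tests of `FibRestU` do not read `W₀`.** -/
theorem fibRestU_mixG_iff (u w : ↥Λ → (Φ → Bool)) : FibRestU υ X (mixG X.W₀ u w) ↔ FibRestU υ X w := by
  have key : ∀ k < X.n, ∀ a ∈ rule (boxGraphT Λ) enc o (traj enc o X.σ k), ¬ (k = X.k₀ ∧ a = X.c) →
      outU υ Λ enc o (mixG X.W₀ u w) (traj enc o X.σ k) a = outU υ Λ enc o w (traj enc o X.σ k) a := by
    intro k hk a ha hne
    have haW := X.not_mem_W₀_of_examined hk ha hne
    by_cases hinit : ∀ v, traj enc o X.σ k v = none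
    · rw [outU_init _ hinit, outU_init _ hinit, mixG_of_not_mem haW]
    · cases hs : sel (boxGraphT Λ) enc (traj enc o X.σ k) with
      | none => rw [outU_none _ hinit hs, outU_none _ hinit hs]
      | some b =>
        rw [outU_sel _ hinit hs, outU_sel _ hinit hs, mixG_of_not_mem haW, usableAt_traj_mixG υ X hk hinit hs]
  constructor
  · intro h k hk a ha hne; rw [← key k hk a ha hne]; exact h k hk a ha hne
  · intro h k hk a ha hne; rw [key k hk a ha hne]; exact h k hk a ha hne

/-- The test of `c` at step `k₀` reads `meetsU (u c) (H w)`. -/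
theorem outU_test_c (u w : ↥Λ → (Φ → Bool)) :
    outU υ Λ enc o (mixG X.W₀ u w) (traj enc o X.σ X.k₀) X.c = meetsU (u X.c) (H υ X w) := by
  rw [outU_sel _ X.hne₀ X.hseld, mixG_of_mem X.c_mem_W₀, usableAt_traj_mixG υ X X.hk₀ X.hne₀ X.hseld]
  -- the usable set of `d` at `traj σ k₀` is its run value, stable up to `k₀`
  obtain ⟨kd, hkd, hdR⟩ := exists_step_of_sel X.σ X.hseld
  rw [usableAt_traj υ _ _ hkd hdR, H, usableX_stable _ _ hdR X.k₀ (by omega)]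

/-- **The fibre factorisation**: `FibU (mixG W₀ u w) ↔ FibRestU w ∧ meetsU (u c) (H w)`. -/
theorem fibU_mixG_iff (u w : ↥Λ → (Φ → Bool)) :
    FibU υ enc o X.n X.σ (mixG X.W₀ u w) ↔ FibRestU υ X w ∧ meetsU (u X.c) (H υ X w) = true := by
  constructor
  · intro h
    refine ⟨(fibRestU_mixG_iff υ X u w).1 fun k hk a ha _ => h k hk a ha, ?_⟩
    have := h X.k₀ X.hk₀ X.c X.hcR
    rw [outU_test_c, X.σ_c] at this
    exact this
  · rintro ⟨hrest, hmeet⟩ k hk a ha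
    by_cases hkc : k = X.k₀ ∧ a = X.c
    · obtain ⟨rfl, rfl⟩ := hkc
      rw [outU_test_c, X.σ_c]; exact hmeet
    · exact ((fibRestU_mixG_iff υ X u w).2 hrest) k hk a ha hkc

/-- **The usable set of `c` at `σ`** (resampled): `υ (u c) (H w)`. -/
theorem usableAt_σ_c (u w : ↥Λ → (Φ → Bool)) :
    usableAt υ Λ enc o (mixG X.W₀ u w) X.σ X.c = υ (u X.c) (H υ X w) := by
  have h1 : usableAt υ Λ enc o (mixG X.W₀ u w) X.σ X.c = usableAt υ Λ enc o (mixG X.W₀ u w) (traj enc o X.σ X.n) X.c := by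
    rw [X.hcons]
  rw [h1, usableAt_traj υ _ _ X.hk₀ X.hcR]
  rw [usableX_succ_of_sel _ _ X.hcR X.hne₀ X.hseld, mixG_of_mem X.c_mem_W₀]
  congr 1
  exact H_mixG υ X u w

/-- **At `σ` the children report `meetsU (u a) (υ (u c) (H w))`** (for a step test function of `C`). -/
theorem outU_mixG_children (u w : ↥Λ → (Φ → Bool)) {g : (↥Λ → Bool) → ℝ} (hg : StepTest X.C g) :
    g (outU υ Λ enc o (mixG X.W₀ u w) X.σ) = g (fun a => if a ∈ X.C then meetsU (u a) (υ (u X.c) (H υ X w)) else false) := by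
  refine hg.2 _ _ fun a ha => ?_
  rw [if_pos ha, outU_sel _ X.σ_ne_init X.hsel, mixG_of_mem (X.mem_W₀.2 (Or.inr ha)), usableAt_σ_c υ X]

/-! ### The origin step -/

section Origin

variable {n : ℕ} {σ : ↥Λ → Option Bool} (hcons : traj enc o σ n = σ) (hsel : sel (boxGraphT Λ) enc σ = some o)
include hcons hsel

/-- **Locality at the origin step**: resampling `W = {o} ∪ C` does not change the usable sets of the sites `≠ o` up to
step `n` (and the usable set of `o` is `Φ` anyway). -/
theorem usableX_mixG_origin (u w : ↥Λ → (Φ → Bool)) :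
    ∀ k ≤ n, ∀ v, v ≠ o → usableX υ Λ enc o (mixG (insert o (rule (boxGraphT Λ) enc o σ)) u w) (readOut σ) k v =
      usableX υ Λ enc o w (readOut σ) k v := by
  have hC : ∀ a ∈ rule (boxGraphT Λ) enc o σ, σ a = none := fun a ha => rule_unrevealed (boxGraphT Λ) enc o σ a ha
  refine usableX_mixG_eq υ σ _ o n (fun j hj hne v hv hvo => ?_) (fun j hj hne b hb => ?_) u w
  · rw [Finset.mem_insert]
    rintro (h | h)
    · exact hvo h
    · have h0 := hC v h
      rw [← hcons] at h0
      exact not_mem_rule_of_run_apply_eq_none (boxGraphT Λ) enc o (readOut σ) hj h0 hv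
  · intro hbo
    have h1 := sel_ne_of_sel_eq (boxGraphT Λ) enc o (readOut σ) hne hb hj
    rw [hbo] at h1
    exact h1 (show sel (boxGraphT Λ) enc (traj enc o σ n) = some o by rw [hcons]; exact hsel)

/-- **The fibre tests of the origin step**: with `W = {o} ∪ C`, `FibU (mixG W u w) ↔ FibRest₀ w ∧ u o = uAll`, where
`FibRest₀` (the tests at steps `≥ 1`) does not read `W`. -/
theorem fibU_origin_mixG_iff (u w : ↥Λ → (Φ → Bool)) :
    FibU υ enc o n σ (mixG (insert o (rule (boxGraphT Λ) enc o σ)) u w) ↔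
      (∀ k < n, ∀ a ∈ rule (boxGraphT Λ) enc o (traj enc o σ k), k ≠ 0 →
        outU υ Λ enc o w (traj enc o σ k) a = (σ a).getD false) ∧ u o = uAll := by
  have hn : 0 < n := by
    refine Nat.pos_of_ne_zero fun hn0 => ?_
    subst hn0
    have h1 := (sel_revealedTrue (boxGraphT Λ) enc hsel).1
    rw [← hcons] at h1; exact absurd h1 (by simp [traj, run])
  have hσo : σ o = some true := (sel_revealedTrue (boxGraphT Λ) enc hsel).1
  set W := insert o (rule (boxGraphT Λ) enc o σ) with hW
  have hC : ∀ a ∈ rule (boxGraphT Λ) enc o σ, σ a = none := fun a ha => rule_unrevealed (boxGraphT Λ) enc o σ a ha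
  have key : ∀ k < n, ∀ a ∈ rule (boxGraphT Λ) enc o (traj enc o σ k), k ≠ 0 →
      outU υ Λ enc o (mixG W u w) (traj enc o σ k) a = outU υ Λ enc o w (traj enc o σ k) a := by
    intro k hk a ha hk0
    have hne : ¬ ∀ v, traj enc o σ k v = none := by
      obtain ⟨k', rfl⟩ := Nat.exists_eq_add_of_le' (Nat.pos_of_ne_zero hk0)
      exact not_initial_run_succ (boxGraphT Λ) enc o (readOut σ) k'
    have haW : a ∉ W := by
      rw [hW, Finset.mem_insert]
      rintro (hao | haC)
      · rw [hao] at ha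
        exact hk0 (step_unique_of_mem_rule (boxGraphT Λ) enc o (readOut σ) ha (root_mem_rule_zero enc o σ))
      · have h0 := hC a haC
        rw [← hcons] at h0
        exact not_mem_rule_of_run_apply_eq_none (boxGraphT Λ) enc o (readOut σ) hk h0 ha
    cases hs : sel (boxGraphT Λ) enc (traj enc o σ k) with
    | none => rw [outU_none _ hne hs, outU_none _ hne hs]
    | some b =>
      have hbo : b ≠ o := by
        intro hbo
        have h1 := sel_ne_of_sel_eq (boxGraphT Λ) enc o (readOut σ) hne hs hk
        rw [hbo] at h1
        exact h1 (show sel (boxGraphT Λ) enc (traj enc o σ n) = some o by rw [hcons]; exact hsel)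
      obtain ⟨kb, hkb, hbR⟩ := exists_step_of_sel σ hs
      rw [outU_sel _ hne hs, outU_sel _ hne hs, mixG_of_not_mem haW, usableAt_traj υ _ _ hkb hbR,
        usableAt_traj υ _ _ hkb hbR, usableX_mixG_origin υ hcons hsel u w (kb + 1) (by omega) b hbo]
  have h00 : ∀ v, traj enc o σ 0 v = none := fun _ => rfl
  constructor
  · intro h
    refine ⟨fun k hk a ha hk0 => by rw [← key k hk a ha hk0]; exact h k hk a ha, ?_⟩
    have h0 := h 0 hn o (root_mem_rule_zero enc o σ)
    rw [outU_init _ h00, mixG_of_mem (Finset.mem_insert_self _ _), hσo] at h0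
    exact of_decide_eq_true h0
  · rintro ⟨h, ho⟩ k hk a ha
    by_cases hk0 : k = 0
    · subst hk0
      have hao : a = o := by
        have h1 : rule (boxGraphT Λ) enc o (traj enc o σ 0) = {o} := by rw [rule, if_pos h00]
        rw [h1, Finset.mem_singleton] at ha; exact ha
      rw [hao, outU_init _ h00, mixG_of_mem (Finset.mem_insert_self _ _), hσo]
      exact decide_eq_true ho
    · rw [key k hk a ha hk0]; exact h k hk a ha hk0

/-- **At the origin step the usable set of `o` read at `σ` is `Φ`**, for every fibre assignment. -/
theorem usableAt_origin (w : ↥Λ → (Φ → Bool)) : usableAt υ Λ enc o w σ o = Finset.univ := by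
  have hn : 0 < n := by
    refine Nat.pos_of_ne_zero fun hn0 => ?_
    subst hn0
    have h1 := (sel_revealedTrue (boxGraphT Λ) enc hsel).1
    rw [← hcons] at h1; exact absurd h1 (by simp [traj, run])
  have h1 : usableAt υ Λ enc o w σ o = usableAt υ Λ enc o w (traj enc o σ n) o := by rw [hcons]
  rw [h1, usableAt_traj υ _ _ hn (root_mem_rule_zero enc o σ)]
  exact usableX_succ_of_init _ _ (root_mem_rule_zero enc o σ) (fun _ => rfl)

omit hcons in
/-- At the origin step the children report `meetsU (u a) Φ` (whatever the resampled assignment). -/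
theorem outU_origin_mixG_children (hcons : traj enc o σ n = σ) (u w : ↥Λ → (Φ → Bool)) {g : (↥Λ → Bool) → ℝ}
    (hg : StepTest (rule (boxGraphT Λ) enc o σ) g) :
    g (outU υ Λ enc o (mixG (insert o (rule (boxGraphT Λ) enc o σ)) u w) σ) =
      g (fun a => if a ∈ rule (boxGraphT Λ) enc o σ then meetsU (u a) (Finset.univ : Finset Φ) else false) := by
  have hne : ¬ ∀ v, σ v = none := fun h => by
    have := (sel_revealedTrue (boxGraphT Λ) enc hsel).1; rw [h o] at this; exact absurd this (by simp)
  refine hg.2 _ _ fun a ha => ?_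
  rw [if_pos ha, outU_sel _ hne hsel, mixG_of_mem (Finset.mem_insert_of_mem ha), usableAt_origin υ hcons hsel]

end Origin

end UFib

end Summit.CriticalPhenomena.PercolationContinuityZ3.Theorems.Pcint

end
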